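import Mathlib.Analysis.SpecialFunctions.Complex.Arg
import HarnessLib

/-!
# Turning and winding of planar polylines

Topic `Literature/Probability/LatticeModels`; definition request `defn-PolylineWinding`
(routes `CriticalPhenomena/SAWScalingLimit/{SAWResidueField, SAWDevelopingMap, SAWParafermion}`).

The *winding* (total signed turning of the direction, in radians) of a planar polyline, as used
for lattice interfaces and self-avoiding walks: S. Smirnov, *Conformal invariance in random
cluster models. I*, Ann. of Math. 172 (2010), §2.2 ("the winding `W_γ(z)`", the total turning
of the tangent of `γ`); H. Duminil-Copin, S. Smirnov, *The connective constant of the honeycomb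
lattice equals `√(2+√2)`*, Ann. of Math. 175 (2012), §2 ("we define its winding `W_γ(a, b)` as
the total rotation of the direction in radians when `γ` is traversed from `a` to `b`").

## Contents (namespace `Literature.Probability.LatticeModels.Polyline`, exported to
`Literature.Probability.LatticeModels`)

* `turning z₁ z₂ z₃ = arg ((z₃ - z₂) / (z₂ - z₁)) ∈ (-π, π]`, the signed turning angle at `z₂`;
  `turning_add_add` (a straight continuation does not turn).
* `winding : List ℂ → ℝ`, the sum of the turning angles at the interior points of a polyline;
  `winding_nil`, `winding_singleton`, `winding_pair`, `winding_cons_cons_cons` (simp API).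

## Why this file exists, and how the old names keep working (read before deduplicating)

This is the self-contained polyline-geometry block of
`Literature/Probability/LatticeModels/FermionicObservable.lean` (its section "Turning and
winding of planar polylines"), reproduced **verbatim** (same bodies, same statements, same
docstrings, same `simp` attributes) so that the self-avoiding-walk files
`RandomPlanarGeometry/HexParafermion.lean` and `RandomPlanarGeometry/SAWParafermion.lean`, which
imported `FermionicObservable` *only* for `winding`, can import this Mathlib-only module instead
of the FK-Ising cone (`FermionicObservable`, `RandomCluster`, … together with the unproved named
fact `isSHolomorphic_fkIsingObservable`, Smirnov 2010 Lemma 4.4, which is irrelevant to the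
self-avoiding walk).

The declarations live in the sub-namespace `…LatticeModels.Polyline` (one fully-qualified name,
one module: `FermionicObservable` still declares `…LatticeModels.winding` itself until its copy
of the block is deleted), and the command
`export Polyline (turning turning_add_add winding … winding_cons_cons_cons)` at the end of this
file registers the OLD names `Literature.Probability.LatticeModels.turning`, `….winding`,
`….winding_nil`, … as *aliases* of them (Lean's persistent alias table, the mechanism behind
`export`; aliases travel with `import`). Hence every existing user — fully qualified
(`Literature.Probability.LatticeModels.winding γ.points`), through
`open Literature.Probability.LatticeModels`, or written inside that namespace — elaborates
UNCHANGED against this module once its import points here. Consequences, all intended: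

* A module importing **both** this file and `FermionicObservable` sees the real constant
  `…LatticeModels.winding` *and* the alias: fully-qualified references then resolve to the real
  constant, while SHORT references (`winding` under `open`/`namespace …LatticeModels`) are
  reported ambiguous by Lean (an error naming both candidates, never a silent change). No module
  does this today (apart from the regenerated umbrella files, which mention no names); a file
  that must import both writes `Polyline.winding`.
* The last step of the move — `FermionicObservable.lean` importing this file and dropping its
  copy of the block — needs NO change in any of its importers thanks to the aliases, but it
  removes declarations that importers mention textually, so it is an operator-side atomic
  commit (gate lint `removes-referenced-decl`), recorded on the work item `defn-PolylineWinding`.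
  Until then the two copies agree term for term (`rfl`), and the alias prober will report the
  lemmas below as aliases of the `FermionicObservable` ones: the duplicate to delete is the block
  in `FermionicObservable.lean`, **not** this file (deleting this one would pull the FK-Ising
  cone back into the SAW routes).

## Design choices and junk values (as in `FermionicObservable`)

* `turning z₁ z₂ z₃ = arg ((z₃ - z₂) / (z₂ - z₁)) ∈ (-π, π]`; degenerate (repeated) points give
  `arg 0 = 0` or `arg` of a junk quotient (Mathlib `x / 0 = 0`), documented junk; a U-turn
  counts `+π` (`arg (-1) = π`).
* Lists with fewer than three points have winding `0`. The winding is additive at a common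
  segment and invariant under complex-affine maps `z ↦ κ z + μ`, `κ ≠ 0` (proved downstream in
  `RandomPlanarGeometry/HexParafermionProofs.lean`: `winding_append_cons_cons`,
  `winding_map_affine`).
* Mathlib has no turning/winding of polylines; the only Mathlib anchor is `Complex.arg`
  (`Mathlib.Analysis.SpecialFunctions.Complex.Arg`, the sole Mathlib import).
-/

noncomputable section

namespace Literature.Probability.LatticeModels.Polyline

/-! ### Turning and winding of planar polylines -/

/-- The signed turning angle at `z₂` of the polyline `z₁ → z₂ → z₃`: the argument
`arg ((z₃ - z₂) / (z₂ - z₁)) ∈ (-π, π]` of the quotient of the outgoing by the incoming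
increment (counter-clockwise positive). Junk (`arg` of `0` or of a junk quotient) if two
consecutive points coincide. (Smirnov 2010, §2.2, "winding = total turning of the tangent".) [cite: Smirnov2010, §2.2  "winding = total turning of the ta] -/
def turning (z₁ z₂ z₃ : ℂ) : ℝ := Complex.arg ((z₃ - z₂) / (z₂ - z₁))

/-- A straight continuation has zero turning (also for `v = 0`, by the junk value `arg 0 = 0`).
(Smirnov 2010, §2.2.) [cite: Smirnov2010, §2.2] -/
@[simp] theorem turning_add_add (z v : ℂ) : turning z (z + v) (z + v + v) = 0 := by
  rcases eq_or_ne v 0 with rfl | hv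
  · simp [turning]
  · simp [turning, div_self hv]

/-- The winding (total signed turning, in radians) of the polyline through the list of points
`zs`: the sum of the turning angles `turning zᵢ zᵢ₊₁ zᵢ₊₂` at all interior points. Lists with
fewer than three points have winding `0`. (Smirnov 2010, §2.2, `W_γ`.) [cite: Smirnov2010, §2.2   W_γ] -/
def winding : List ℂ → ℝ
  | z₁ :: z₂ :: z₃ :: zs => turning z₁ z₂ z₃ + winding (z₂ :: z₃ :: zs)
  | _ => 0

/-- The empty polyline has zero winding. (Smirnov 2010, §2.2.) [cite: Smirnov2010, §2.2] -/
@[simp] theorem winding_nil : winding [] = 0 := rfl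

/-- A single point has zero winding. (Smirnov 2010, §2.2.) [cite: Smirnov2010, §2.2] -/
@[simp] theorem winding_singleton (z : ℂ) : winding [z] = 0 := rfl

/-- A single segment has zero winding. (Smirnov 2010, §2.2.) [cite: Smirnov2010, §2.2] -/
@[simp] theorem winding_pair (z₁ z₂ : ℂ) : winding [z₁, z₂] = 0 := rfl

/-- The recursive step of `winding`. (Smirnov 2010, §2.2.) [cite: Smirnov2010, §2.2] -/
@[simp] theorem winding_cons_cons_cons (z₁ z₂ z₃ : ℂ) (zs : List ℂ) :
    winding (z₁ :: z₂ :: z₃ :: zs) = turning z₁ z₂ z₃ + winding (z₂ :: z₃ :: zs) := rfl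

end Literature.Probability.LatticeModels.Polyline

/-! ### The historical names

`export` registers `Literature.Probability.LatticeModels.turning`, `….turning_add_add`,
`….winding`, `….winding_nil`, `….winding_singleton`, `….winding_pair`,
`….winding_cons_cons_cons` as aliases of the declarations above, in this module and in every
module importing it (see the module docstring). -/

namespace Literature.Probability.LatticeModels

export Polyline (turning turning_add_add winding winding_nil winding_singleton winding_pair
  winding_cons_cons_cons)

end Literature.Probability.LatticeModels

end
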